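import Literature.AlgebraicGeometry.Limits.LocalizationProperSpread
import Literature.AlgebraicGeometry.Limits.LocalizationSeparatedSpread
import Literature.AlgebraicGeometry.Limits.GenericProperCover
import Literature.AlgebraicGeometry.Resolution.ChowLemmaNoetherianRing
import Literature.AlgebraicGeometry.Morphisms.GenericFlatness
import Literature.AlgebraicGeometry.Motives.VarietiesProperProofs
import HarnessLib

/-!
# Limits of schemes: properness of the generic fibre spreads out to a dense open of a Noetherian
# integral base (Stacks 081F; EGA IV₃ 8.10.5 (xii)) — the case `Spec Frac A = lim_s Spec A[1/s]`

Topic `Literature/AlgebraicGeometry/Limits`. Theorems only (no definition, no named fact); sequel of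
`Limits/LocalizationProperSpread` and `Limits/GenericProperCover`.

The Stacks Project, Tag 081F (= EGA IV₃ Thm. 8.10.5 (xii)): for `S = lim Sᵢ` a limit of a directed
system of quasi-compact quasi-separated schemes with affine transition maps and `X → S` proper,
descended to a finitely presented `Xᵢ → Sᵢ`, some `Xⱼ = Xᵢ ×_{Sᵢ} Sⱼ → Sⱼ` is proper. This file proves
it for the system of basic open neighbourhoods of the generic point of a NOETHERIAN INTEGRAL affine
base: `A` a Noetherian domain, `K = Frac A`, `Spec K = lim_{s ≠ 0} Spec A[1/s]`
(`Limits/LocalizationDiagram`, `Limits/LocalizationProdLimit`), and a PRESCRIBED `A`-scheme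
`P → Spec A`, quasi-compact, quasi-separated and locally of finite presentation, whose generic fibre
`P ×_A Spec K → Spec K` is proper: then `P ×_A Spec T → Spec T` is proper for every model `T` of
`A[1/t]`, `t` any multiple of some `s ≠ 0` (`LocApprox.exists_forall_isProper_snd`). In particular a
PROJECTIVE generic fibre spreads to a proper family over a dense open of the prescribed base
(`LocApprox.exists_forall_isProper_snd_of_isProjectiveOver`) — the form in which the moduli/spreading
arguments of the tree consume it (a given integral model, not a model chosen by the proof as in
`Limits/SmoothProjectiveSpreadPrescribedBase`).

Proof (the one of Stacks 081F, assembled from the tree's organs):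
* `exists_proper_generic_cover_of_isProper` — Chow's lemma over the Noetherian ring `K`
  (`Resolution/ChowLemmaNoetherianRing.chow_proper_noetherian`, NO integrality of the generic fibre)
  gives `π : X' ↠ P_K` proper surjective with `X' ↪ ℙⁿ_K` closed; the scheme-theoretic closure `Y` of
  `X'` in `ℙⁿ_A` is proper over `A` with generic fibre `X'` (`Motives.isPullback_toImage_of_flat_mono`,
  Stacks 081I), whence an `A`-morphism `a : Y ⊗ Spec K → P` with `(a, pr₂)` surjective onto `P_K` —
  this is `Limits/GenericProperCover.exists_proper_generic_cover` with its hypothesis `IsIntegral E`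
  removed;
* `a` spreads out to a stage `Y ⊗ Spec A[1/s₁] → P` (Stacks 01ZC,
  `LocApprox.exists_whiskerLeft_comp_eq`);
* `LocApprox.exists_forall_flat_snd` — GENERIC FLATNESS (Görtz–Wedhorn I Cor. 10.85 / EGA IV₂ 6.9.1,
  `Morphisms/GenericFlatness.exists_nonempty_flat_morphismRestrict`): `P` being of finite type over the
  Noetherian domain `A`, it is flat over a non-empty open `U ⊆ Spec A`, which contains a basic open
  `D(s₂)`, `s₂ ≠ 0`, hence `P ×_A Spec T → Spec T` is flat for every model `T` of `A[1/t]`, `s₂ ∣ t`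
  (base change of `P|_U → U` along `Spec T ≅ D(t) ⊆ U`);
* separatedness of the stages below some `s₃` (EGA IV₃ 8.10.5 (v),
  `LocApprox.exists_forall_isSeparated_snd`);
* below `s = s₁ s₂ s₃` the last step of Stacks 081F applies verbatim
  (`LocApprox.isProper_snd_of_generic_cover`: the spread-out cover `(g, pr₂) : Y ⊗ Spec A[1/t] → P_t` is
  proper with closed image containing the generic fibre, the complement maps onto an open subset of
  `Spec A` missing the generic point — here flatness is used — hence is empty; so `P_t → Spec A[1/t]`
  is universally closed, separated and of finite type), and properness passes from the stage
  `Spec A[1/t]` to any model `T` of `A[1/t]` by base change along `Spec T ≅ Spec A[1/t]`.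

## Contents

* (private) `of_morphismRestrict_of_range_subset` — a morphism property stable under base change passes
  from `f|_U` to `pullback.snd f i` for any `i` landing in `U`; `of_snd_of_comp_eq` — and from
  `pullback.snd f j` to `pullback.snd f i` whenever `i` factors through `j`.
* `Literature.AlgebraicGeometry.Limits.exists_proper_generic_cover_of_isProper` — the Chow cover of a
  model of a proper (not necessarily integral) `K`-scheme, `K = Frac A`.
* `Literature.AlgebraicGeometry.Limits.LocApprox.exists_forall_flat_snd` — generic flatness at the stages.
* `Literature.AlgebraicGeometry.Limits.LocApprox.exists_forall_isProper_snd` — Stacks 081F for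
  `Spec Frac A = lim Spec A[1/s]`.
* `Literature.AlgebraicGeometry.Limits.LocApprox.exists_forall_isProper_snd_of_isProjectiveOver` — the
  same for a projective generic fibre.

## References

* [StacksProject] The Stacks Project, Tag 081F (Lemma 32.13.1) and its proof; Tags 01ZC, 0200
  (Chow's lemma), 081I, 051R–052B (generic flatness).
* [EGAIV3] A. Grothendieck, J. Dieudonné, EGA IV₃ (Publ. Math. IHÉS 28, 1966), Thm. 8.10.5 (v),
  (xii).
* [EGAIV2] EGA IV₂ (Publ. Math. IHÉS 24, 1965), Thm. 6.9.1 (generic flatness).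
* [GortzWedhorn2020] U. Görtz, T. Wedhorn, *Algebraic Geometry I: Schemes*, 2nd ed. (2020),
  Thm. 10.84, Cor. 10.85, Thm. 13.100.
-/

noncomputable section

universe u

open CategoryTheory CategoryTheory.Limits AlgebraicGeometry MonoidalCategory
  CartesianMonoidalCategory TopologicalSpace

namespace Literature.AlgebraicGeometry.Limits

open Literature.AlgebraicGeometry.Motives (SchemeOver specOver IsProjectiveOver)
open Literature.AlgebraicGeometry.Motives Literature.AlgebraicGeometry.Resolution

set_option backward.isDefEq.respectTransparency false

/-! ## Two base-change lemmas -/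

section BaseChange

variable (W : MorphismProperty Scheme.{u}) [W.IsStableUnderBaseChange]

/-- If `i : T → Y` factors as `i = e ≫ j` then `pullback.snd f i` is a base change of `pullback.snd f j`
(along `e`); so a morphism property stable under base change passes from `P ×_Y Y' → Y'` to
`P ×_Y T → T`. [folklore] -/
private theorem of_snd_of_comp_eq {X Y Y' T : Scheme.{u}} (f : X ⟶ Y) (j : Y' ⟶ Y)
    (hW : W (pullback.snd f j)) {i : T ⟶ Y} (e : T ⟶ Y') (he : e ≫ j = i) :
    W (pullback.snd f i) := by
  subst he
  have h := W.pullback_snd (pullback.snd f j) e hW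
  rw [← pullbackLeftPullbackSndIso_inv_snd_snd f j e]
  exact (W.cancel_left_of_respectsIso (pullbackLeftPullbackSndIso f j e).inv _).mpr h

/-- If `f|_U : f⁻¹(U) → U` has a property stable under base change and `i : T → Y` lands in the open
`U ⊆ Y`, then `P ×_Y T → T` has it (`i` factors through `U ↪ Y`, and `f|_U` is the base change of `f`
along `U ↪ Y`). [folklore] -/
private theorem of_morphismRestrict_of_range_subset {X Y T : Scheme.{u}} (f : X ⟶ Y) (U : Y.Opens)
    (hW : W (f ∣_ U)) (i : T ⟶ Y) (hi : Set.range i ⊆ (U : Set Y)) : W (pullback.snd f i) := by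
  have hW' : W (pullback.snd f U.ι) := by
    rw [← pullbackRestrictIsoRestrict_hom_morphismRestrict]
    exact (W.cancel_left_of_respectsIso (pullbackRestrictIsoRestrict f U).hom _).mpr hW
  have hrange : Set.range i ⊆ Set.range U.ι := by rwa [Scheme.Opens.range_ι]
  exact of_snd_of_comp_eq W f U.ι hW' (IsOpenImmersion.lift U.ι i hrange)
    (IsOpenImmersion.lift_fac U.ι i hrange)

end BaseChange

/-! ## A proper `A`-scheme generically covering a model of a proper `K`-scheme (Chow, non-integral) -/

section Cover

variable {A K : Type u} [CommRing A] [Field K] [Algebra A K] [IsFractionRing A K]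

/-- **A proper `A`-scheme generically covering a model of a proper `K`-scheme** (`K = Frac A`; the
construction in the proof of Stacks 081F, with Chow's lemma in its general Noetherian form so that
NO integrality of the generic fibre is assumed). Let `P → Spec A` and `e₀ : P ×_A Spec K ≅ E` with
`E → Spec K` proper. Then there are a proper `A`-scheme `Y` and an `A`-morphism `a : Y ⊗ Spec K → P`
with `(a, pr₂) : Y ⊗ Spec K → P ⊗ Spec K` surjective: take a Chow cover `π : X' ↠ E` with
`X' ↪ ℙⁿ_K` closed (`ChowLemmaRing.chow_proper_noetherian` over the Noetherian ring `K`), let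
`Y ⊆ ℙⁿ_A` be the scheme-theoretic closure of `X'` (proper over `A`, generic fibre `X'` by
`Motives.isPullback_toImage_of_flat_mono`), and `a = (Y ⊗ Spec K ≅ X' ↠ E ≅ P ×_A Spec K → P)`.
Same proof as `exists_proper_generic_cover`, which assumes `E` integral.
[cite: StacksProject, Tag 081F (proof) with Tags 0200, 081I] [cite: GortzWedhorn2020, Thm. 13.100] -/
theorem exists_proper_generic_cover_of_isProper (P : SchemeOver A) (E : SchemeOver K)
    [IsProper E.hom] (e₀ : (Over.pullback (specOver A K).hom).obj P ≅ E) :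
    ∃ (Y : SchemeOver A) (a : Y ⊗ specOver A K ⟶ P), IsProper Y.hom ∧
      Function.Surjective (lift a (snd Y (specOver A K))).left := by
  classical
  haveI : Module.Flat A K := IsLocalization.flat K (nonZeroDivisors A)
  -- Chow's lemma over the Noetherian ring `K` (no integrality needed)
  obtain ⟨n, X', π, ι, hι, hπ, hπs, hw, -⟩ :=
    ChowLemmaRing.chow_proper_noetherian (R := K) E.left E.hom
  letI := MvPolynomial.gradedAlgebra (σ := Fin (n + 1)) (R := K)
  letI := MvPolynomial.gradedAlgebra (σ := Fin (n + 1)) (R := A)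
  haveI : @IsClosedImmersion X' (Proj (MvPolynomial.homogeneousSubmodule (Fin (n + 1)) K)) ι := hι
  haveI : IsProper π := hπ
  haveI : Surjective π := hπs
  -- the base change `Spec K → Spec A`, a flat monomorphism
  set i : Spec (.of K) ⟶ Spec (.of A) := Spec.map (CommRingCat.ofHom (algebraMap A K)) with hi
  haveI : Flat i := Motives.flat_specMap_of_isLocalization A K (nonZeroDivisors A)
  haveI : Mono i := Motives.mono_specMap_of_isLocalization A K (nonZeroDivisors A)
  -- projective spaces: `ℙⁿ_K = ℙⁿ_A ×_A Spec K`
  set pA := ProjBaseChangeRing.projToSpec (Fin (n + 1)) A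
  set pK := ProjBaseChangeRing.projToSpec (Fin (n + 1)) K
  set φ := Proj.map (ProjBaseChangeRing.mapGraded A K (Fin (n + 1)))
    (ProjBaseChangeRing.irrelevant_le_map A K (Fin (n + 1)))
  have hP : IsPullback φ pK pA i := ProjBaseChangeRing.isPullback_projMap A K (Fin (n + 1))
  haveI : QuasiCompact φ := MorphismProperty.of_isPullback hP.flip inferInstance
  have hιw : ι ≫ pK = π ≫ E.hom := hw
  -- the closure `Y` of `X'` in `ℙⁿ_A`: proper over `A`, generic fibre `X'`
  set g := ι ≫ φ
  set f : g.image ⟶ Spec (.of A) := g.imageι ≫ pA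
  have Hgen : IsPullback g.toImage (π ≫ E.hom) f i :=
    Motives.isPullback_toImage_of_flat_mono i pA pK φ hP ι (π ≫ E.hom) hιw
  haveI : IsProper pA := ProjBaseChangeRing.isProper_projToSpec (Fin (n + 1)) A
  haveI : IsProper f := inferInstance
  let Y : SchemeOver A := Over.mk f
  -- the morphism `a : Y ⊗ Spec K ≅ X' → E ≅ P_K → P`
  let u : (Y ⊗ specOver A K).left ⟶ X' := Hgen.isoPullback.inv
  have hu : u ≫ π ≫ E.hom = pullback.snd f i := Hgen.isoPullback_inv_snd
  let aleft : (Y ⊗ specOver A K).left ⟶ P.left :=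
    u ≫ π ≫ e₀.inv.left ≫ pullback.fst P.hom (specOver A K).hom
  have haw : aleft ≫ P.hom = (Y ⊗ specOver A K).hom := by
    have h1 : e₀.inv.left ≫ pullback.snd P.hom (specOver A K).hom = E.hom := Over.w e₀.inv
    simp only [aleft, Category.assoc, pullback.condition]
    rw [reassoc_of% h1, reassoc_of% hu, Over.tensorObj_hom]
    exact pullback.condition.symm
  let a : Y ⊗ specOver A K ⟶ P := Over.homMk aleft haw
  refine ⟨Y, a, ‹IsProper f›, ?_⟩
  -- `(a, pr₂) = (Y ⊗ Spec K ≅ X' ↠ E ≅ P_K)` is surjective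
  have hleft : (lift a (snd Y (specOver A K))).left = u ≫ π ≫ e₀.inv.left := by
    rw [Over.lift_left]
    apply pullback.hom_ext
    · rw [pullback.lift_fst]
      simp only [a, aleft, Over.homMk_left, Category.assoc]
    · rw [pullback.lift_snd, Over.snd_left, Category.assoc, Category.assoc]
      have h1 : e₀.inv.left ≫ pullback.snd P.hom (specOver A K).hom = E.hom := Over.w e₀.inv
      rw [h1, hu]
      rfl
  haveI : IsIso e₀.inv.left := ((Over.forget _).mapIso e₀.symm).isIso_hom
  rw [hleft]
  exact (u ≫ π ≫ e₀.inv.left).surjective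

end Cover

namespace LocApprox

/-! ## Generic flatness at the stages `Spec A[1/t]` -/

/-- **Generic flatness, read at the stages of `Spec Frac A = lim Spec A[1/s]`** (Görtz–Wedhorn I
Cor. 10.85 / EGA IV₂ 6.9.1): for `A` a Noetherian domain and `P → Spec A` of finite type there is
`s ≠ 0` such that for every multiple `t` of `s` and every model `T` of `A[1/t]` the base change
`P ×_A Spec T → Spec T` is flat. Indeed `P` is flat over a non-empty open `U ⊆ Spec A`
(`Morphisms.exists_nonempty_flat_morphismRestrict`), which contains a basic open `D(s)` with `s ≠ 0`,
and `Spec T → Spec A` is an open immersion onto `D(t) ⊆ D(s) ⊆ U`.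
[cite: GortzWedhorn2020, Cor. 10.85] [cite: EGAIV2, Thm. 6.9.1] -/
theorem exists_forall_flat_snd {A : Type u} [CommRing A] [IsDomain A] [IsNoetherianRing A]
    (P : SchemeOver A) [LocallyOfFiniteType P.hom] [QuasiCompact P.hom] :
    ∃ s ∈ nonZeroDivisors A, ∀ t : A, s ∣ t →
      ∀ (T : Type u) [CommRing T] [Algebra A T] [IsLocalization.Away t T],
        Flat (pullback.snd P.hom (Spec.map (CommRingCat.ofHom (algebraMap A T)))) := by
  classical
  haveI : IsNoetherianRing (CommRingCat.of A) := ‹IsNoetherianRing A›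
  haveI : IsLocallyNoetherian (Spec (CommRingCat.of A)) :=
    (isLocallyNoetherian_Spec (R := CommRingCat.of A)).mpr ‹_›
  haveI : IsDomain (CommRingCat.of A) := ‹IsDomain A›
  obtain ⟨U, hUne, hflat⟩ := Morphisms.exists_nonempty_flat_morphismRestrict P.hom
  obtain ⟨x, hx⟩ := hUne
  -- a basic open `D(s) ∋ x` inside `U`
  obtain ⟨V, ⟨s, rfl⟩, hxs, hsU⟩ :=
    (PrimeSpectrum.isTopologicalBasis_basic_opens (R := A)).exists_subset_of_mem_open hx U.isOpen
  simp only at hxs hsU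
  have hsU' : (PrimeSpectrum.basicOpen s : Set (PrimeSpectrum A)) ⊆ (U.1 : Set (PrimeSpectrum A)) :=
    hsU
  have hs0 : s ≠ 0 := by
    rintro rfl
    exact (PrimeSpectrum.mem_basicOpen (0 : A) x).mp hxs (Ideal.zero_mem _)
  refine ⟨s, mem_nonZeroDivisors_of_ne_zero hs0, fun t hst T _ _ _ => ?_⟩
  refine of_morphismRestrict_of_range_subset @Flat P.hom U hflat _ ?_
  have hle : (PrimeSpectrum.basicOpen t : Set (PrimeSpectrum A)) ⊆ PrimeSpectrum.basicOpen s := by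
    obtain ⟨c, rfl⟩ := hst
    exact PrimeSpectrum.basicOpen_mul_le_left s c
  change Set.range (PrimeSpectrum.comap (algebraMap A T)) ⊆ (U.1 : Set (PrimeSpectrum A))
  rw [PrimeSpectrum.localization_away_comap_range T t]
  exact subset_trans hle hsU' 

/-! ## Properness spreads out from the generic fibre (Stacks 081F) -/

variable {A : Type u} [CommRing A] [IsDomain A] [IsNoetherianRing A]
  (K : Type u) [Field K] [Algebra A K] [IsFractionRing A K]

omit [IsDomain A] [IsNoetherianRing A] in
/-- The canonical open immersion `Spec T → Spec A` of a model `T` of `A[1/t]`, `t ∈ S`, factors through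
the stage `Spec A[1/t]` of the localization diagram (both are open immersions onto `D(t)`).
[folklore] -/
private theorem exists_comp_stage_hom_eq (S : Submonoid A) (t : Idx S) (T : Type u) [CommRing T]
    [Algebra A T] [IsLocalization.Away t.val T] :
    ∃ e : Spec (.of T) ⟶ ((baseDiagram S).obj t).left,
      e ≫ ((baseDiagram S).obj t).hom = Spec.map (CommRingCat.ofHom (algebraMap A T)) := by
  have hrange : Set.range (Spec.map (CommRingCat.ofHom (algebraMap A T))) ⊆
      Set.range ((baseDiagram S).obj t).hom := by
    change Set.range (PrimeSpectrum.comap (algebraMap A T)) ⊆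
      Set.range (PrimeSpectrum.comap (algebraMap A (loc S t)))
    rw [PrimeSpectrum.localization_away_comap_range T t.val,
      PrimeSpectrum.localization_away_comap_range (loc S t) t.val]
  exact ⟨IsOpenImmersion.lift _ _ hrange, IsOpenImmersion.lift_fac _ _ hrange⟩

/-- **Properness of the generic fibre spreads out** (The Stacks Project, Tag 081F; EGA IV₃ 8.10.5 (xii)),
for the cofiltered system of basic open neighbourhoods of the generic point of a Noetherian integral
affine scheme. Let `A` be a Noetherian domain with fraction field `K` and `P → Spec A` quasi-compact,
quasi-separated and locally of finite presentation, with PROPER generic fibre `P ×_A Spec K → Spec K`.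
Then there is `s ≠ 0` in `A` such that for every non-zero-divisor multiple `t` of `s` and every model
`T` of `A[1/t]` (`IsLocalization.Away t T`) the base change `P ×_A Spec T → Spec T` is proper. Proof:
a Chow cover of the generic fibre closed up in `ℙⁿ_A` (`exists_proper_generic_cover_of_isProper`),
spread to a stage (`exists_whiskerLeft_comp_eq`), generic flatness (`exists_forall_flat_snd`) and
spreading of separatedness (`exists_forall_isSeparated_snd`) below a common stage, then
`isProper_snd_of_generic_cover`; finally base change along `Spec T ≅ Spec A[1/t]`.
[cite: StacksProject, Tag 081F] [cite: EGAIV3, Thm. 8.10.5 (xii)] -/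
theorem exists_forall_isProper_snd (P : SchemeOver A) [QuasiCompact P.hom] [QuasiSeparated P.hom]
    [LocallyOfFinitePresentation P.hom]
    (h : IsProper (pullback.snd P.hom (Spec.map (CommRingCat.ofHom (algebraMap A K))))) :
    ∃ s ∈ nonZeroDivisors A, ∀ t ∈ nonZeroDivisors A, s ∣ t →
      ∀ (T : Type u) [CommRing T] [Algebra A T] [IsLocalization.Away t T],
        IsProper (pullback.snd P.hom (Spec.map (CommRingCat.ofHom (algebraMap A T)))) := by
  classical
  -- the generic fibre `E := P ×_A Spec K`
  let E : SchemeOver K := (Over.pullback (specOver A K).hom).obj P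
  have hE : E.hom = pullback.snd P.hom (Spec.map (CommRingCat.ofHom (algebraMap A K))) := rfl
  haveI : IsProper E.hom := by rw [hE]; exact h
  -- Step 1: a proper `A`-scheme `Y` generically covering `P`, spread out to a stage `s₁`
  obtain ⟨Y, a, hY, ha⟩ := exists_proper_generic_cover_of_isProper P E (Iso.refl _)
  haveI := hY
  haveI : LocallyOfFiniteType P.hom := inferInstance
  obtain ⟨s₁, g, hg⟩ := LocApprox.exists_whiskerLeft_comp_eq K (S := nonZeroDivisors A) (P := Y) a
  -- Step 2: flatness and separatedness of the small stages
  obtain ⟨s₂, hs₂S, hs₂⟩ := exists_forall_flat_snd P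
  have hsepK : IsSeparated (pullback.snd P.hom (Spec.map (CommRingCat.ofHom (algebraMap A K)))) :=
    inferInstance
  obtain ⟨s₃, hs₃S, hs₃⟩ := LocApprox.exists_forall_isSeparated_snd (nonZeroDivisors A) K P hsepK
  -- the common stage `s = s₁ s₂ s₃`
  refine ⟨s₁.val * (s₂ * s₃), mul_mem s₁.mem (mul_mem hs₂S hs₃S), fun t htS hst T _ _ _ => ?_⟩
  let t' : Idx (nonZeroDivisors A) := ⟨t, htS⟩
  have ht₁ : t' ≤ s₁ := Idx.le_iff.mpr (dvd_trans (dvd_mul_right _ _) hst)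
  have ht₂ : s₂ ∣ t'.val := dvd_trans (dvd_mul_of_dvd_right (dvd_mul_right _ _) _) hst
  have ht₃ : s₃ ∣ t'.val := dvd_trans (dvd_mul_of_dvd_right (dvd_mul_left _ _) _) hst
  haveI hfl : Flat (pullback.snd P.hom ((baseDiagram (nonZeroDivisors A)).obj t').hom) :=
    hs₂ t'.val ht₂ (loc (nonZeroDivisors A) t')
  haveI hsep : IsSeparated (pullback.snd P.hom ((baseDiagram (nonZeroDivisors A)).obj t').hom) :=
    hs₃ t'.val ht₃ (loc (nonZeroDivisors A) t')
  -- Step 3: properness over the stage `t'`, by the spread-out Chow cover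
  have hgt : (Y ◁ leg (nonZeroDivisors A) K t') ≫
      ((Y ◁ (baseDiagram _).map (homOfLE ht₁)) ≫ g) = a := by
    rw [← MonoidalCategory.whiskerLeft_comp_assoc, leg_comp_map, hg]
  have ha' : Function.Surjective (lift ((Y ◁ leg (nonZeroDivisors A) K t') ≫
      ((Y ◁ (baseDiagram _).map (homOfLE ht₁)) ≫ g)) (snd Y (specOver A K))).left := by
    rw [hgt]; exact ha
  have hpr : IsProper (pullback.snd P.hom ((baseDiagram (nonZeroDivisors A)).obj t').hom) :=
    isProper_snd_of_generic_cover (B := K) le_rfl Y P t' _ ha'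
  -- Step 4: any model `T` of `A[1/t]`
  obtain ⟨e, he⟩ := exists_comp_stage_hom_eq (nonZeroDivisors A) t' T
  exact of_snd_of_comp_eq @IsProper P.hom _ hpr e he

/-- **A projective generic fibre spreads to a proper family over a dense open of the prescribed base**
(Stacks 081F for a projective generic fibre; EGA IV₃ 8.10.5 (xii)–(xiii)): `A` a Noetherian domain,
`K = Frac A`, `P → Spec A` quasi-compact, quasi-separated and locally of finite presentation with
`P ×_A Spec K` PROJECTIVE over `K`; then `P ×_A Spec T → Spec T` is proper for every model `T` of
`A[1/t]`, `t` any non-zero-divisor multiple of some `s ≠ 0` (a projective `K`-scheme is proper,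
`Motives.IsProjectiveOver.isProper`, then `exists_forall_isProper_snd`).
[cite: StacksProject, Tag 081F] [cite: EGAIV3, Thm. 8.10.5 (xii), (xiii)] -/
theorem exists_forall_isProper_snd_of_isProjectiveOver (P : SchemeOver A) [QuasiCompact P.hom]
    [QuasiSeparated P.hom] [LocallyOfFinitePresentation P.hom]
    (h : IsProjectiveOver ((Over.pullback (specOver A K).hom).obj P)) :
    ∃ s ∈ nonZeroDivisors A, ∀ t ∈ nonZeroDivisors A, s ∣ t →
      ∀ (T : Type u) [CommRing T] [Algebra A T] [IsLocalization.Away t T],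
        IsProper (pullback.snd P.hom (Spec.map (CommRingCat.ofHom (algebraMap A T)))) :=
  exists_forall_isProper_snd K P h.isProper

end LocApprox

end Literature.AlgebraicGeometry.Limits

end
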